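/-
Copyright (c) 2026 the pub-hodgecm-mathlib formalisation cell (harness21).  Prover seat hodgecm-mathlib-K2Liu-p11 (g0), Track B «K2-LIT»,
#184♮ = hLiu418 = `stmt-HodgeConjecture-24832`; LEAD F0P6-plan (g13) «M-157o» S5-W1-arch FILE 2 census, road (C): the generic
Paley–Wiener∕contour lemma.  THEOREMS ONLY (Mathlib-only).
-/
import Mathlib.Analysis.Complex.CauchyIntegral
import Mathlib.Analysis.SpecialFunctions.ImproperIntegrals
import Mathlib.MeasureTheory.Integral.IntegralEqImproper
import HarnessLib

/-!
# A Paley–Wiener vanishing lemma: the Fourier transform of a function holomorphic and `O(1/|z|²)` on the closed upper half-plane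
vanishes on the negative half-line

Cell `hodgecm-mathlib`, crux item hLiu418 = `stmt-HodgeConjecture-24832` (helper lane `--supports`, count-neutral).  Generic, Mathlib-only
capital for S5-W1-arch FILE 2 (road (C) of the 09:5xZ census): the even rank-one archimedean Whittaker integrals
`∫ (b−i)^{j−1}(b+i)^{−j−1} e^{−2πihb} db` are instances (pole only at `b = −i`).

`fourier_eq_zero_of_differentiable_upperHalfPlane`: if `F` is complex-differentiable at every point of the closed upper half-plane
`{im z ≥ 0}` and `‖F z‖ ≤ C/(1 + ‖z‖²)` there, then `∫_ℝ F(x) e^{−2πihx} dx = 0` for every `h < 0`.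
Proof: Cauchy on the rectangle `[−R, R] × [0, T]` (Mathlib `Complex.integral_boundary_rect_eq_zero_of_differentiableOn`); the top side is
`≤ 2RC/(1+T²) → 0` (`T → ∞`), each vertical side is `≤ C/((1+R²)·2π|h|) → 0` (`R → ∞`), and the bottom side tends to `∫_ℝ`.
References: [Bump1997, §1.6] (the argument), folklore.
HONEST LABEL: HC_CM is proved only modulo the 7 printed citations (2 remaining named inputs: hLiu418 = stmt-HodgeConjecture-24832,
h413 = stmt-HodgeConjecture-24833) until rung 0 closes; count-neutral helper, closes no socket.
-/

set_option autoImplicit false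
set_option linter.dupNamespace false

noncomputable section

open Complex MeasureTheory Set Filter intervalIntegral
open scoped Topology

namespace Summit.HodgeConjecture.HodgeConjecture.Cruxes.HLiu418.K2LiuUpperHalfPlaneFourierVanishing

/-! ## §1  The twisted function `G(z) = F(z)·e^{−2πihz}` on the closed upper half-plane -/

/-- `‖e^{−2πihz}‖ = e^{2πh·im z}`. [folklore] -/
theorem norm_cexp_phase (h : ℝ) (z : ℂ) : ‖Complex.exp (-(2 * Real.pi * I * h * z))‖ = Real.exp (2 * Real.pi * h * z.im) := by
  rw [Complex.norm_exp]
  congr 1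
  simp [Complex.mul_re, Complex.mul_im]

/-- On the closed upper half-plane and for `h < 0`: `‖e^{−2πihz}‖ ≤ 1`. [folklore] -/
theorem norm_cexp_phase_le_one {h : ℝ} (hh : h < 0) {z : ℂ} (hz : 0 ≤ z.im) : ‖Complex.exp (-(2 * Real.pi * I * h * z))‖ ≤ 1 := by
  rw [norm_cexp_phase, Real.exp_le_one_iff]
  have h1 : 0 ≤ 2 * Real.pi * (-h) * z.im := mul_nonneg (mul_nonneg (by positivity) (neg_pos.2 hh).le) hz
  linarith

/-- The bound constant is nonnegative (evaluate the hypothesis at `z = 0`). [folklore] -/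
theorem nonneg_of_bound {F : ℂ → ℂ} {C : ℝ} (hB : ∀ z : ℂ, 0 ≤ z.im → ‖F z‖ ≤ C / (1 + ‖z‖ ^ 2)) : 0 ≤ C := by
  have h := hB 0 le_rfl
  simp at h
  exact (norm_nonneg _).trans h

/-- The twisted bound: `‖F(z)e^{−2πihz}‖ ≤ C/(1+‖z‖²)` on the closed upper half-plane (`h < 0`). [folklore] -/
theorem norm_twist_le {F : ℂ → ℂ} {C : ℝ} (hB : ∀ z : ℂ, 0 ≤ z.im → ‖F z‖ ≤ C / (1 + ‖z‖ ^ 2)) {h : ℝ} (hh : h < 0)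
    {z : ℂ} (hz : 0 ≤ z.im) : ‖F z * Complex.exp (-(2 * Real.pi * I * h * z))‖ ≤ C / (1 + ‖z‖ ^ 2) := by
  rw [norm_mul]
  have h1 := hB z hz
  have h2 := norm_cexp_phase_le_one hh hz
  have hC : 0 ≤ C / (1 + ‖z‖ ^ 2) := div_nonneg (nonneg_of_bound hB) (by positivity)
  calc ‖F z‖ * ‖Complex.exp (-(2 * Real.pi * I * h * z))‖ ≤ C / (1 + ‖z‖ ^ 2) * 1 :=
        mul_le_mul h1 h2 (norm_nonneg _) hC
    _ = C / (1 + ‖z‖ ^ 2) := mul_one _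

/-! ## §2  The three sides -/

/-- **TOP SIDE**: `‖∫_{−R}^{R} G(x + iT) dx‖ ≤ C/(1+T²) · 2R` (`T ≥ 0`, `R ≥ 0`). [folklore] -/
theorem norm_top_le {F : ℂ → ℂ} {C : ℝ} (hB : ∀ z : ℂ, 0 ≤ z.im → ‖F z‖ ≤ C / (1 + ‖z‖ ^ 2)) {h : ℝ} (hh : h < 0)
    {R T : ℝ} (hR : 0 ≤ R) (hT : 0 ≤ T) :
    ‖∫ x in -R..R, F (x + T * I) * Complex.exp (-(2 * Real.pi * I * h * (x + T * I)))‖ ≤ C / (1 + T ^ 2) * (2 * R) := by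
  have hC := nonneg_of_bound hB
  have h := intervalIntegral.norm_integral_le_of_norm_le_const (a := -R) (b := R) (C := C / (1 + T ^ 2))
    (f := fun x : ℝ => F (x + T * I) * Complex.exp (-(2 * Real.pi * I * h * (x + T * I)))) (fun x _ => ?_)
  · rw [show |R - -R| = 2 * R by rw [sub_neg_eq_add, ← two_mul, abs_of_nonneg (by positivity)]] at h
    exact h
  · have him : ((x : ℂ) + T * I).im = T := by simp
    refine (norm_twist_le hB hh (by rw [him]; exact hT)).trans ?_
    refine div_le_div_of_nonneg_left hC (by positivity) ?_
    have : T ^ 2 ≤ ‖(x : ℂ) + T * I‖ ^ 2 := by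
      rw [Complex.sq_norm, Complex.normSq_apply]
      simp
      nlinarith [sq_nonneg x]
    linarith

/-- **VERTICAL SIDES, integrability**: `y ↦ G(a + iy)` is integrable on `(0, ∞)` (`h < 0`; bound `C/(1+a²)·e^{2πhy}`). [folklore] -/
theorem integrableOn_side {F : ℂ → ℂ} {C : ℝ} (hF : ∀ z : ℂ, 0 ≤ z.im → DifferentiableAt ℂ F z)
    (hB : ∀ z : ℂ, 0 ≤ z.im → ‖F z‖ ≤ C / (1 + ‖z‖ ^ 2)) {h : ℝ} (hh : h < 0) (a : ℝ) :
    IntegrableOn (fun y : ℝ => F (a + y * I) * Complex.exp (-(2 * Real.pi * I * h * (a + y * I)))) (Ioi 0) := by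
  have hC := nonneg_of_bound hB
  have hcont : ContinuousOn (fun y : ℝ => F (a + y * I) * Complex.exp (-(2 * Real.pi * I * h * (a + y * I)))) (Ioi 0) := by
    intro y hy
    have hz : 0 ≤ ((a : ℂ) + y * I).im := by simp; exact le_of_lt hy
    have hline : ContinuousAt (fun y : ℝ => (a : ℂ) + y * I) y := by fun_prop
    have hFc : ContinuousAt (fun y : ℝ => F ((a : ℂ) + y * I)) y :=
      ContinuousAt.comp (g := F) (f := fun y : ℝ => (a : ℂ) + y * I) (x := y) (hF _ hz).continuousAt hline
    exact (hFc.mul ((by fun_prop : Continuous fun y : ℝ =>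
      Complex.exp (-(2 * Real.pi * I * h * ((a : ℂ) + y * I)))).continuousAt)).continuousWithinAt
  refine Integrable.mono' ((integrableOn_exp_mul_Ioi (a := 2 * Real.pi * h) (by nlinarith [Real.pi_pos]) 0).const_mul C)
    (hcont.aestronglyMeasurable measurableSet_Ioi) ?_
  refine (ae_restrict_mem measurableSet_Ioi).mono fun y (hy : 0 < y) => ?_
  have hz : 0 ≤ ((a : ℂ) + y * I).im := by simp; exact hy.le
  rw [norm_mul, norm_cexp_phase]
  have him : ((a : ℂ) + y * I).im = y := by simp
  rw [him]
  have h1 : ‖F (a + y * I)‖ ≤ C := by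
    refine (hB _ hz).trans (div_le_self hC ?_)
    nlinarith [norm_nonneg ((a : ℂ) + y * I)]
  exact mul_le_mul_of_nonneg_right h1 (Real.exp_pos _).le

/-- **VERTICAL SIDES, bound**: `‖∫_0^∞ G(a + iy) dy‖ ≤ C/(1+a²) · (2π|h|)⁻¹`. [folklore] -/
theorem norm_side_le {F : ℂ → ℂ} {C : ℝ}
    (hB : ∀ z : ℂ, 0 ≤ z.im → ‖F z‖ ≤ C / (1 + ‖z‖ ^ 2)) {h : ℝ} (hh : h < 0) (a : ℝ) :
    ‖∫ y in Ioi (0 : ℝ), F (a + y * I) * Complex.exp (-(2 * Real.pi * I * h * (a + y * I)))‖ ≤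
      C / (1 + a ^ 2) * (1 / (-(2 * Real.pi * h))) := by
  have hC := nonneg_of_bound hB
  have ha : 2 * Real.pi * h < 0 := by nlinarith [Real.pi_pos]
  have hint := (integrableOn_exp_mul_Ioi ha 0).const_mul (C / (1 + a ^ 2))
  refine (MeasureTheory.norm_integral_le_of_norm_le hint ?_).trans ?_
  · refine (ae_restrict_mem measurableSet_Ioi).mono fun y (hy : 0 < y) => ?_
    have hz : 0 ≤ ((a : ℂ) + y * I).im := by simp; exact hy.le
    have him : ((a : ℂ) + y * I).im = y := by simp
    rw [norm_mul, norm_cexp_phase, him]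
    have hFz := hB _ hz
    have hn : a ^ 2 ≤ ‖(a : ℂ) + y * I‖ ^ 2 := by
      rw [Complex.sq_norm, Complex.normSq_apply]
      simp
      nlinarith [sq_nonneg y]
    have hle : C / (1 + ‖(a : ℂ) + y * I‖ ^ 2) ≤ C / (1 + a ^ 2) := div_le_div_of_nonneg_left hC (by positivity) (by linarith)
    exact mul_le_mul_of_nonneg_right (hFz.trans hle) (Real.exp_pos _).le
  · rw [MeasureTheory.integral_const_mul, integral_exp_mul_Ioi ha 0, mul_zero, Real.exp_zero]
    apply le_of_eq
    ring

/-! ## §3  The vanishing -/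

/-- **PALEY–WIENER VANISHING**: `F` complex-differentiable on the closed upper half-plane with `‖F z‖ ≤ C/(1+‖z‖²)` there ⇒
`∫_ℝ F(x)·e^{−2πihx} dx = 0` for every `h < 0` (rectangle `[−R,R]×[0,T]`, `T → ∞` then `R → ∞`). [Bump1997, §1.6] (the contour argument). -/
theorem fourier_eq_zero_of_differentiable_upperHalfPlane {F : ℂ → ℂ} {C : ℝ} (hF : ∀ z : ℂ, 0 ≤ z.im → DifferentiableAt ℂ F z)
    (hB : ∀ z : ℂ, 0 ≤ z.im → ‖F z‖ ≤ C / (1 + ‖z‖ ^ 2)) {h : ℝ} (hh : h < 0) :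
    ∫ x : ℝ, F x * Complex.exp (-(2 * Real.pi * I * h * x)) = 0 := by
  have hC := nonneg_of_bound hB
  obtain ⟨G, hG⟩ : ∃ G : ℂ → ℂ, ∀ z, G z = F z * Complex.exp (-(2 * Real.pi * I * h * z)) := ⟨_, fun z => rfl⟩
  have hGF : (fun x : ℝ => F x * Complex.exp (-(2 * Real.pi * I * h * x))) = fun x : ℝ => G x := funext fun x => (hG x).symm
  rw [hGF]
  have hGd : ∀ z : ℂ, 0 ≤ z.im → DifferentiableAt ℂ G z := by
    intro z hz
    have h1 : DifferentiableAt ℂ (fun z => F z * Complex.exp (-(2 * Real.pi * I * h * z))) z := (hF z hz).mul (by fun_prop)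
    exact h1.congr_of_eventuallyEq (Filter.Eventually.of_forall fun w => hG w)
  -- (1) the rectangle identity, for `R, T ≥ 0`
  have hrect : ∀ R T : ℝ, 0 ≤ R → 0 ≤ T →
      (∫ x in -R..R, G x) = (∫ x in -R..R, G (x + T * I)) - I * (∫ y in (0 : ℝ)..T, G (R + y * I)) + I * (∫ y in (0 : ℝ)..T, G (-R + y * I)) := by
    intro R T hR hT
    have hD : DifferentiableOn ℂ G (Set.uIcc (-(R : ℂ)).re ((R : ℂ) + T * I).re ×ℂ Set.uIcc (-(R : ℂ)).im ((R : ℂ) + T * I).im) := by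
      intro z hz
      refine (hGd z ?_).differentiableWithinAt
      have hz2 : z.im ∈ Set.uIcc (-(R : ℂ)).im ((R : ℂ) + T * I).im := hz.2
      have him0 : (-(R : ℂ)).im = 0 := by simp
      have himT : ((R : ℂ) + T * I).im = T := by simp
      rw [him0, himT] at hz2
      rcases Set.mem_uIcc.1 hz2 with h' | h'
      · exact h'.1
      · linarith [h'.1, h'.2]
    have h0 := Complex.integral_boundary_rect_eq_zero_of_differentiableOn G (-(R : ℂ)) ((R : ℂ) + T * I) hD
    simp only [neg_re, ofReal_re, neg_im, ofReal_im, neg_zero, add_re, mul_re, I_re, mul_zero, I_im, mul_one, sub_self, add_zero,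
      add_im, mul_im, zero_add, ofReal_zero, zero_mul, smul_eq_mul, ofReal_neg] at h0
    linear_combination h0
  -- (2) `T → ∞` for fixed `R ≥ 0`
  have hlimT : ∀ R : ℝ, 0 ≤ R →
      (∫ x in -R..R, G x) = -I * (∫ y in Ioi (0 : ℝ), G (R + y * I)) + I * (∫ y in Ioi (0 : ℝ), G (-R + y * I)) := by
    intro R hR
    have htop : Tendsto (fun T : ℝ => ∫ x in -R..R, G (x + T * I)) atTop (𝓝 0) := by
      rw [tendsto_zero_iff_norm_tendsto_zero]
      have hbound : ∀ᶠ T : ℝ in atTop, ‖∫ x in -R..R, G (x + T * I)‖ ≤ C / (1 + T ^ 2) * (2 * R) := by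
        filter_upwards [eventually_ge_atTop (0 : ℝ)] with T hT
        simp only [hG]
        exact norm_top_le hB hh hR hT
      have hlim : Tendsto (fun T : ℝ => C / (1 + T ^ 2) * (2 * R)) atTop (𝓝 0) := by
        have h1 : Tendsto (fun T : ℝ => 1 + T ^ 2) atTop atTop :=
          tendsto_atTop_add_const_left _ _ (tendsto_pow_atTop two_ne_zero)
        have h2 : Tendsto (fun T : ℝ => C / (1 + T ^ 2)) atTop (𝓝 0) := tendsto_const_nhds.div_atTop h1
        simpa using h2.mul_const (2 * R)
      exact squeeze_zero_norm' (by filter_upwards [hbound] with T hT; simpa using hT) hlim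
    have hside : ∀ a : ℝ, Tendsto (fun T : ℝ => ∫ y in (0 : ℝ)..T, G (a + y * I)) atTop (𝓝 (∫ y in Ioi (0 : ℝ), G (a + y * I))) := by
      intro a
      have hi := integrableOn_side hF hB hh a
      simp only [← hG] at hi
      exact intervalIntegral_tendsto_integral_Ioi 0 hi tendsto_id
    have hsideR := hside R
    have hsideL := hside (-R)
    simp only [Complex.ofReal_neg] at hsideL
    have hconst : Tendsto (fun T : ℝ => ∫ x in -R..R, G x) atTop
        (𝓝 (0 - I * (∫ y in Ioi (0 : ℝ), G (R + y * I)) + I * (∫ y in Ioi (0 : ℝ), G (-R + y * I)))) := by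
      have ht := (htop.sub (hsideR.const_mul I)).add (hsideL.const_mul I)
      refine ht.congr' ?_
      filter_upwards [eventually_ge_atTop (0 : ℝ)] with T hT
      rw [hrect R T hR hT]
    have := tendsto_nhds_unique tendsto_const_nhds hconst
    rw [this]
    ring
  -- (3) `R → ∞`
  have hGint : Integrable fun x : ℝ => G x := by
    have hcont : Continuous fun x : ℝ => G x := by
      refine continuous_iff_continuousAt.2 fun x => ?_
      exact ((hGd x (by simp)).continuousAt).comp Complex.continuous_ofReal.continuousAt
    refine Integrable.mono' (integrable_inv_one_add_sq.const_mul C) hcont.aestronglyMeasurable (Filter.Eventually.of_forall fun x => ?_)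
    have h1 := norm_twist_le hB hh (z := (x : ℂ)) (by simp)
    rw [Complex.norm_real, Real.norm_eq_abs, sq_abs, div_eq_mul_inv, ← hG] at h1
    exact h1
  have hwhole : Tendsto (fun R : ℝ => ∫ x in -R..R, G x) atTop (𝓝 (∫ x : ℝ, G x)) :=
    intervalIntegral_tendsto_integral hGint tendsto_neg_atTop_atBot tendsto_id
  have hzero : Tendsto (fun R : ℝ => ∫ x in -R..R, G x) atTop (𝓝 0) := by
    rw [tendsto_zero_iff_norm_tendsto_zero]
    have hbound : ∀ᶠ R : ℝ in atTop, ‖∫ x in -R..R, G x‖ ≤ 2 * (C / (1 + R ^ 2) * (1 / (-(2 * Real.pi * h)))) := by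
      filter_upwards [eventually_ge_atTop (0 : ℝ)] with R hR
      rw [hlimT R hR]
      have h1 := norm_side_le hB hh R
      have h2 := norm_side_le hB hh (-R)
      rw [neg_sq] at h2
      simp only [← hG] at h1 h2
      simp only [Complex.ofReal_neg] at h2
      calc ‖-I * (∫ y in Ioi (0 : ℝ), G (R + y * I)) + I * (∫ y in Ioi (0 : ℝ), G (-R + y * I))‖
          ≤ ‖-I * (∫ y in Ioi (0 : ℝ), G (R + y * I))‖ + ‖I * (∫ y in Ioi (0 : ℝ), G (-R + y * I))‖ := norm_add_le _ _
        _ ≤ C / (1 + R ^ 2) * (1 / (-(2 * Real.pi * h))) + C / (1 + R ^ 2) * (1 / (-(2 * Real.pi * h))) := by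
            rw [norm_mul, norm_mul, norm_neg, Complex.norm_I, one_mul, one_mul]
            exact add_le_add h1 h2
        _ = 2 * (C / (1 + R ^ 2) * (1 / (-(2 * Real.pi * h)))) := by ring
    have hlim : Tendsto (fun R : ℝ => 2 * (C / (1 + R ^ 2) * (1 / (-(2 * Real.pi * h))))) atTop (𝓝 0) := by
      have h1 : Tendsto (fun R : ℝ => 1 + R ^ 2) atTop atTop :=
        tendsto_atTop_add_const_left _ _ (tendsto_pow_atTop two_ne_zero)
      have h2 : Tendsto (fun R : ℝ => C / (1 + R ^ 2)) atTop (𝓝 0) := tendsto_const_nhds.div_atTop h1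
      simpa using (h2.mul_const (1 / (-(2 * Real.pi * h)))).const_mul 2
    exact squeeze_zero_norm' (by filter_upwards [hbound] with R hR; simpa using hR) hlim
  exact tendsto_nhds_unique hwhole hzero

end Summit.HodgeConjecture.HodgeConjecture.Cruxes.HLiu418.K2LiuUpperHalfPlaneFourierVanishing

end
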